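import Summits.QuantumAdvantage.QuantumAdvantage.Theorems.StakeDialB

/-!
# StakeDial — part C: kernel instances (`decide`) and UNCONDITIONAL corollaries in the target's currency

* §G `topChar_canon_three … topChar_canon_ten` — `χ_T(S_n) ≠ 0` for `n = 3, …, 10` with `|T| ≥ n − 1` (`T = univ` for even
  `n`, `univ ∖ {0}` / `univ ∖ {2}` for odd `n`), `topCharLaw3_upto_ten`, and `sparse_loses_upto_eleven`: on every cycle
  `C_N`, `4 ≤ N ≤ 11`, a degree-`d` strategy silent outside `M` with `|M|(4d+2)+2 ≤ N−1` is not perfect on the odd class.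
* §I exposure instances: `exposed_single_six` / `exposed_single_eight` (every single column of `C_7`, `C_9` is exposed),
  `not_exposed_single_four` (`C_5`: none), `exposed_nonAdjacent_pairs_eight` (all 27 non-adjacent pairs of `C_9`),
  `not_exposed_structured_eight` (alternating / period-3 supports of `C_9` are covering); degree-free corollaries
  `oneColumn_loses_seven`, `oneColumn_loses_nine`, `nonAdjacentPair_loses_nine`.

Kernel `decide` only (no compiled evaluation); the `n = 9, 10` characters need `maxHeartbeats 2·10⁸ / 4·10⁸` (≈ 40 s / 80 s).
Data behind the choices of `T`: `pub/decomp-qadv/decomp-qadv-lens-1/g9/exp/topcoef.py`, `topcoef_even.py`, `deadstake.py`.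
-/

set_option linter.dupNamespace false
set_option linter.style.longLine false

namespace Summit.QuantumAdvantage.QuantumAdvantage.Theorems.StakeDial

open Finset
open Literature.Computability.QuantumComplexity.RingHLF (Rel)
open Literature.Computability.MetaComplexity.Smolensky
open Summit.QuantumAdvantage.AdviceFreeQNC0 (OddZeros xOfU uVec uExt tGuess ringWinU walkExp wtPrefix
  rel_iff_ringWinU xOfU_uVec card_odd_filter_ge)

variable {n : ℕ}

section Instances

set_option maxHeartbeats 4000000 in
/-- `N = 4`. -/
theorem topChar_canon_three : topChar ((univ : Finset (Fin 3)).erase 0) (canon 3) ≠ 0 := by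
  decide

set_option maxHeartbeats 4000000 in
/-- `N = 5`. -/
theorem topChar_canon_four : topChar (univ : Finset (Fin 4)) (canon 4) ≠ 0 := by decide

set_option maxHeartbeats 20000000 in
set_option maxRecDepth 400000 in
/-- `N = 6`. -/
theorem topChar_canon_five : topChar ((univ : Finset (Fin 5)).erase 2) (canon 5) ≠ 0 := by
  decide

set_option maxHeartbeats 20000000 in
set_option maxRecDepth 400000 in
/-- `N = 7`. -/
theorem topChar_canon_six : topChar (univ : Finset (Fin 6)) (canon 6) ≠ 0 := by decide

set_option maxHeartbeats 40000000 in
set_option maxRecDepth 400000 in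
/-- `N = 8`. -/
theorem topChar_canon_seven : topChar ((univ : Finset (Fin 7)).erase 0) (canon 7) ≠ 0 := by
  decide

set_option maxHeartbeats 80000000 in
set_option maxRecDepth 800000 in
/-- `N = 9`. -/
theorem topChar_canon_eight : topChar (univ : Finset (Fin 8)) (canon 8) ≠ 0 := by decide

set_option maxHeartbeats 200000000 in
set_option maxRecDepth 2000000 in
/-- `N = 10`. -/
theorem topChar_canon_nine : topChar ((univ : Finset (Fin 9)).erase 2) (canon 9) ≠ 0 := by
  decide

set_option maxHeartbeats 400000000 in
set_option maxRecDepth 4000000 in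
/-- `N = 11` (≈ 80 s of kernel time). -/
theorem topChar_canon_ten : topChar (univ : Finset (Fin 10)) (canon 10) ≠ 0 := by decide

/-- `TopCharLaw3` holds on the whole kernel-checked range `2 ≤ n ≤ 10`. -/
theorem topCharLaw3_upto_ten (n : ℕ) (hn : 2 ≤ n) (hn10 : n ≤ 10) :
    ∃ T : Finset (Fin n), n ≤ T.card + 1 ∧ topChar T (canon n) ≠ 0 := by
  interval_cases n
  · exact ⟨univ, by simp, by decide⟩
  · exact ⟨(univ : Finset (Fin 3)).erase 0, by decide, topChar_canon_three⟩
  · exact ⟨univ, by simp, topChar_canon_four⟩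
  · exact ⟨(univ : Finset (Fin 5)).erase 2, by decide, topChar_canon_five⟩
  · exact ⟨univ, by simp, topChar_canon_six⟩
  · exact ⟨(univ : Finset (Fin 7)).erase 0, by decide, topChar_canon_seven⟩
  · exact ⟨univ, by simp, topChar_canon_eight⟩
  · exact ⟨(univ : Finset (Fin 9)).erase 2, by decide, topChar_canon_nine⟩
  · exact ⟨univ, by simp, topChar_canon_ten⟩

/-- **Unconditional instance of the W-piece (all cycle lengths `4 ≤ N ≤ 11`).**  E.g. on the
`11`-cycle: no strategy with ONE non-silent column of degree `≤ 1` (cost `6 ≤ 8`), or with `≤ 4`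
non-silent columns of degree `0`, is perfect on the odd class — by the budget law alone. -/
theorem sparse_loses_upto_eleven {n : ℕ} (hn : 2 ≤ n) (hn10 : n ≤ 10) {d : ℕ}
    (P : Fin (n + 1) → CubeFn (ZMod 3) (n + 1)) (hP : ∀ i, P i ∈ lowDeg (ZMod 3) (n + 1) d)
    (M : Finset (Fin (n + 1))) (hM : P ∈ silent M) (hB : M.card * (4 * d + 2) + 2 ≤ n) :
    ∃ x : Fin (n + 1) → Bool, OddZeros x ∧ ¬ Rel x (fun i => decide (P i x = 1)) := by
  obtain ⟨T, hT, hχ⟩ := topCharLaw3_upto_ten n hn hn10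
  exact budget_law hn P hP M hM T hχ (by omega)

end Instances

section ExposureInstances

set_option maxHeartbeats 40000000 in
set_option maxRecDepth 400000 in
/-- `N = 7`: every single column is exposed. -/
theorem exposed_single_six : ∀ k : Fin 7, ∃ u, u ∈ exposed 6 {k} := by
  simp only [mem_exposed]; decide

set_option maxHeartbeats 200000000 in
set_option maxRecDepth 800000 in
/-- `N = 9`: every single column is exposed. -/
theorem exposed_single_eight : ∀ k : Fin 9, ∃ u, u ∈ exposed 8 {k} := by
  simp only [mem_exposed]; decide

set_option maxHeartbeats 4000000 in
set_option maxRecDepth 400000 in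
/-- `N = 5` contrast: NO single column is exposed (the smallest cycle is special). -/
theorem not_exposed_single_four : ∀ k : Fin 5, ¬ ∃ u, u ∈ exposed 4 {k} := by
  simp only [mem_exposed]; decide

set_option maxHeartbeats 400000000 in
set_option maxRecDepth 800000 in
/-- `N = 9`: every NON-ADJACENT pair of columns is exposed. -/
theorem exposed_nonAdjacent_pairs_eight :
    ∀ a b : Fin 9, a ≠ b → b.val ≠ (a.val + 1) % 9 → a.val ≠ (b.val + 1) % 9 → ∃ u, u ∈ exposed 8 {a, b} := by
  simp only [mem_exposed]; decide

set_option maxHeartbeats 40000000 in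
set_option maxRecDepth 800000 in
/-- `N = 9`: the alternating support and the period-`3` support are COVERING (not exposed) — their
dead points all have odd canonical count. -/
theorem not_exposed_structured_eight :
    (¬ ∃ u, u ∈ exposed 8 {0, 2, 4, 6}) ∧ (¬ ∃ u, u ∈ exposed 8 {0, 3, 6}) := by
  simp only [mem_exposed]; decide

/-- **Degree-free corollary (`N = 7`)**: a strategy with a single non-silent column, of ANY degree,
is not perfect on the odd class of the `7`-cycle. -/
theorem oneColumn_loses_seven (P : Fin 7 → CubeFn (ZMod 3) 7) (k : Fin 7) (hM : P ∈ silent {k}) :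
    ∃ x : Fin 7 → Bool, OddZeros x ∧ ¬ Rel x (fun i => decide (P i x = 1)) :=
  deadStake_law (n := 6) (by norm_num) P {k} hM (exposed_single_six k)

/-- **Degree-free corollary (`N = 9`)**: one non-silent column of ANY degree loses on the `9`-cycle. -/
theorem oneColumn_loses_nine (P : Fin 9 → CubeFn (ZMod 3) 9) (k : Fin 9) (hM : P ∈ silent {k}) :
    ∃ x : Fin 9 → Bool, OddZeros x ∧ ¬ Rel x (fun i => decide (P i x = 1)) :=
  deadStake_law (n := 8) (by norm_num) P {k} hM (exposed_single_eight k)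

/-- **Degree-free corollary (`N = 9`)**: a strategy supported on two NON-adjacent columns, of ANY
degree, is not perfect on the odd class of the `9`-cycle (adjacent pairs ARE perfect, §H). -/
theorem nonAdjacentPair_loses_nine (P : Fin 9 → CubeFn (ZMod 3) 9) (a b : Fin 9) (hab : a ≠ b)
    (h₁ : b.val ≠ (a.val + 1) % 9) (h₂ : a.val ≠ (b.val + 1) % 9) (hM : P ∈ silent {a, b}) :
    ∃ x : Fin 9 → Bool, OddZeros x ∧ ¬ Rel x (fun i => decide (P i x = 1)) :=
  deadStake_law (n := 8) (by norm_num) P {a, b} hM (exposed_nonAdjacent_pairs_eight a b hab h₁ h₂)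

end ExposureInstances

end Summit.QuantumAdvantage.QuantumAdvantage.Theorems.StakeDial
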